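import Summits.Ventures.CertifiedManyBodySolver.Observables.PinningFieldResponseBracket
import HarnessLib

/-!
# Pinning-field response menu nodes (II′): Hellmann–Feynman brackets for the `d`-WAVE SOURCED grand-canonical
# Hubbard torus — ground-state vectors, the tracial stair, today's inputs, what the FLOOR side needs

HONEST FRAMING: zero compute; every statement is a PROVED implication whose numerical inputs are
hypotheses of the stated shape (no certificate is constructed or claimed); positivity/kinematic scale until
fed; a bracket on the sourced pair amplitude at `h > 0` is NOT a statement about `d`-wave order of the
source-free Hubbard model (that needs a finite-`h` Kennedy–Lieb–Shastry / Koma–Tasaki inequality — cell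
`hubbard-cq`); not a superconductivity verdict; no phase sentence.

Cell `hubbard-obs` (D-0042 / D-0082 (c-2)), seat `hubbard-obs-pin-2` (`prover-hubbard-obs-pin-2-g0-0`); sequel
of `Observables/PinningFieldResponseBracket.lean` (generic Hellmann–Feynman bracket: `K_L` Hermitian, any form
factor, every torus-limit state in the sourced window). Here `K_L = H_L(1,U) − μN_L`, `g = dWaveFormFactor`,
`A_L(h) = dWaveSourceTorus L U μ h` (Koma–Tasaki 1994 §1), `P₀` the local `d`-wave pair at the origin, and all
energy inputs carry the certificate SHAPE of record `∃ L₀, ∀ L ≥ L₀, … E₀(dWaveSourceTorus L U μ h') …`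
(`dWaveSourceTorus_groundEnergy_ge_of_window_certificate[_d4]_eventually`; `PairSourceEnergyCertAlong.ofEnergyRows`).

## Contents

* §3′ torus limits `ω` of GROUND-STATE VECTORS of `A_{Ls j}(h)` with an eventual ground-energy cap
  `E₀(A_L(h)) ≤ u·L²` and cuts `ℓ₁·L² ≤ E₀(A_L(h₁))`, `ℓ₂·L² ≤ E₀(A_L(h₂))`, `h₁ < h < h₂`:
  `(ℓ₁ − u)/(2(h − h₁)) ≤ Re ω(P₀) ≤ (u − ℓ₂)/(2(h₂ − h))` (`…_of_dWaveSource_groundStates`: upper / lower / Icc),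
  and the sign node `re_expect_localPairAt_nonneg_of_dWaveSource_groundStates` (`h > 0`).
* §4 the tracial stair `m_L(h) = dWaveSourceDensity L U μ h` (Koma–Tasaki's `F(U,μ,h) = liminf_L m_{L+1}(h)` is ONE
  stair of `dWaveOrderParameter`, `le_dWaveOrderParameter_iff_forall`): finite-`L` bracket
  `dWaveSourceDensity_le_of_cap_of_cut` / `le_dWaveSourceDensity_of_cut_of_cap`, the eventual forms
  `le_liminf_dWaveSourceDensity_of_cut_of_cap` (the stair FLOOR a finite-`h` KLS/Koma–Tasaki inequality consumes)
  and `limsup_dWaveSourceDensity_le_of_cap_of_cut`, and `dWaveOrderParameter_le_of_cap_of_cut` (obs-p1's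
  ceiling re-keyed: cap AT `h`, certificate shape of record).
* §5 today's inputs: the CAP at any `h` is fed by a CANONICAL source-free upper row at any density
  (`exists_groundEnergy_dWaveSourceTorus_le_of_canonical_upper`: `E₀(A_L(h)) ≤ E₀(A_L(0)) ≤ (hi − μn + ε)L²`,
  Legendre + "the source never raises the energy"), whence the UPPER bracket fed by `(hi, ℓ₂)` alone
  (`re_expect_localPairAt_le_of_canonical_upper_of_sourced_lower`); and the honesty nodes
  `cut_le_cap_of_sourceFree_cap` / `floor_nonpos_of_sourceFree_cap`: a cut below `h` never beats a cap inherited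
  from `h = 0` (`ℓ₁ ≤ u₀`), so the FLOOR side is vacuous unless the cap at `h` comes from a SOURCED variational
  state certified strictly below the certified source-free lower edge — the ask this file hands to the pilots /
  upper crew. Quality (planning, not a claim): both edges are LINEAR in the energy slacks,
  `width = (u − ℓ₂)/(2(h₂ − h)) − (ℓ₁ − u)/(2(h − h₁))`.

References: T. Koma, H. Tasaki, J. Stat. Phys. 76 (1994) 745, §1 [KomaTasaki1994]; R. B. Griffiths,
Phys. Rev. 152 (1966) 240, §II [Griffiths1966]; H. Tasaki (2020) §2.1 [Tasaki2020]; T. Kennedy, E. H. Lieb,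
B. S. Shastry, J. Stat. Phys. 53 (1988) 1019, §1 (the consumer class of a fixed-`h` floor) [KennedyLiebShastry1988].
-/

noncomputable section

namespace Summit.Ventures.CertifiedManyBodySolver.Observables

open Matrix Literature.MathematicalPhysics.QuantumLattice Literature.Probability.LatticeModels
open Literature.MathematicalPhysics.QuantumLattice.HubbardWave0 ThermodynamicLimit Filter Topology
open scoped ComplexOrder BigOperators

/-! ### §3′ The `d`-wave sourced grand-canonical torus: torus limits of GROUND-STATE VECTORS -/

section DWave

variable {U μ : ℝ}

/-- The cap hypothesis of §3 for ground-state vectors of `dWaveSourceTorus`: an eventual UPPER bound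
`E₀(A_L(h)) ≤ u·L²` on the sourced ground energies is a cap for every family of unit ground-state vectors.
[cite: Tasaki2020, §2.1] -/
theorem dWaveSource_cap_of_groundStates {ψ : ∀ L, Fock (Orb (FermionTorus 2 L))} {Ls : ℕ → ℕ}
    (hLs : Tendsto Ls atTop atTop) {h : ℝ}
    (hgs : ∀ (j : ℕ) [NeZero (Ls j)], dWaveSourceTorus (Ls j) U μ h *ᵥ ψ (Ls j) =
      (((dWaveSourceTorus (Ls j) U μ h).groundEnergy : ℝ) : ℂ) • ψ (Ls j))
    (h1 : ∀ j, star (ψ (Ls j)) ⬝ᵥ ψ (Ls j) = 1) {u : ℝ}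
    (hcapE : ∃ L₀ : ℕ, ∀ (L : ℕ) [NeZero L], L₀ ≤ L → (dWaveSourceTorus L U μ h).groundEnergy ≤ u * (L : ℝ) ^ 2) :
    ∃ j₀ : ℕ, ∀ (j : ℕ) [NeZero (Ls j)], j₀ ≤ j →
      (expect (hubbardTorusWith 2 (Ls j) 1 U μ - (h : ℂ) • (pairField dWaveFormFactor (Ls j) +
        (pairField dWaveFormFactor (Ls j))ᴴ)) (ψ (Ls j))).re ≤ u * ((Ls j : ℕ) : ℝ) ^ 2 := by
  obtain ⟨L₀, hL₀⟩ := hcapE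
  obtain ⟨j₀, hj₀⟩ := Filter.eventually_atTop.1 (hLs.eventually_ge_atTop L₀)
  refine ⟨j₀, fun j _ hj => ?_⟩
  rw [← dWaveSourceTorus_eq, expect, re_rayleigh_eq_groundEnergy_of_eigen (h1 j) (hgs j)]
  exact hL₀ (Ls j) (hj₀ j hj)

/-- **UPPER bracket for torus-limit ground states of the `d`-wave sourced grand-canonical Hubbard torus.** Let
`ω` be a torus limit of translation averages of unit ground-state vectors `ψ_{Ls j}` of
`A_{Ls j}(h) = dWaveSourceTorus (Ls j) U μ h`, `Ls → ∞`; let `E₀(A_L(h)) ≤ u·L²` and `ℓ·L² ≤ E₀(A_L(h₂))` for all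
large `L`, `h < h₂`. Then the `d`-wave pair amplitude obeys `Re ω(P₀) ≤ (u − ℓ)/(2(h₂ − h))`.
[cite: KomaTasaki1994, §1] -/
theorem re_expect_localPairAt_le_of_dWaveSource_groundStates {ω : InfVolFermionState 2}
    {ψ : ∀ L, Fock (Orb (FermionTorus 2 L))} {Ls : ℕ → ℕ} (hω : ω.IsTorusLimitOf ψ Ls)
    (hLs : Tendsto Ls atTop atTop) {h : ℝ}
    (hgs : ∀ (j : ℕ) [NeZero (Ls j)], dWaveSourceTorus (Ls j) U μ h *ᵥ ψ (Ls j) =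
      (((dWaveSourceTorus (Ls j) U μ h).groundEnergy : ℝ) : ℂ) • ψ (Ls j))
    (h1 : ∀ j, star (ψ (Ls j)) ⬝ᵥ ψ (Ls j) = 1) {h₂ u ℓ : ℝ} (hlt : h < h₂)
    (hcap : ∃ L₀ : ℕ, ∀ (L : ℕ) [NeZero L], L₀ ≤ L → (dWaveSourceTorus L U μ h).groundEnergy ≤ u * (L : ℝ) ^ 2)
    (hcut : ∃ L₀ : ℕ, ∀ (L : ℕ) [NeZero L], L₀ ≤ L → ℓ * (L : ℝ) ^ 2 ≤ (dWaveSourceTorus L U μ h₂).groundEnergy) :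
    (ω.expect (pairRegion (insert (0 : Site 2) unitSteps) 0)
        (localPairAt (insert (0 : Site 2) unitSteps) dWaveFormFactor 0)).re ≤ (u - ℓ) / (2 * (h₂ - h)) :=
  re_expect_localPairAt_le_of_sourced_cap_of_cut dWaveFormFactor (fun L => hubbardTorusWith 2 L 1 U μ)
    (fun L _ => isHermitian_hubbardTorusWith L 1 U μ) hω hLs h1 hlt (dWaveSource_cap_of_groundStates hLs hgs h1 hcap)
    hcut

/-- **LOWER bracket for torus-limit ground states of the `d`-wave sourced torus**: with `ℓ·L² ≤ E₀(A_L(h₁))`,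
`h₁ < h`, and the cap `E₀(A_L(h)) ≤ u·L²` (both for all large `L`): `(ℓ − u)/(2(h − h₁)) ≤ Re ω(P₀)`.
[cite: KomaTasaki1994, §1] -/
theorem le_re_expect_localPairAt_of_dWaveSource_groundStates {ω : InfVolFermionState 2}
    {ψ : ∀ L, Fock (Orb (FermionTorus 2 L))} {Ls : ℕ → ℕ} (hω : ω.IsTorusLimitOf ψ Ls)
    (hLs : Tendsto Ls atTop atTop) {h : ℝ}
    (hgs : ∀ (j : ℕ) [NeZero (Ls j)], dWaveSourceTorus (Ls j) U μ h *ᵥ ψ (Ls j) =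
      (((dWaveSourceTorus (Ls j) U μ h).groundEnergy : ℝ) : ℂ) • ψ (Ls j))
    (h1 : ∀ j, star (ψ (Ls j)) ⬝ᵥ ψ (Ls j) = 1) {h₁ u ℓ : ℝ} (hlt : h₁ < h)
    (hcap : ∃ L₀ : ℕ, ∀ (L : ℕ) [NeZero L], L₀ ≤ L → (dWaveSourceTorus L U μ h).groundEnergy ≤ u * (L : ℝ) ^ 2)
    (hcut : ∃ L₀ : ℕ, ∀ (L : ℕ) [NeZero L], L₀ ≤ L → ℓ * (L : ℝ) ^ 2 ≤ (dWaveSourceTorus L U μ h₁).groundEnergy) :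
    (ℓ - u) / (2 * (h - h₁)) ≤ (ω.expect (pairRegion (insert (0 : Site 2) unitSteps) 0)
        (localPairAt (insert (0 : Site 2) unitSteps) dWaveFormFactor 0)).re :=
  le_re_expect_localPairAt_of_sourced_cut_of_cap dWaveFormFactor (fun L => hubbardTorusWith 2 L 1 U μ)
    (fun L _ => isHermitian_hubbardTorusWith L 1 U μ) hω hLs h1 hlt (dWaveSource_cap_of_groundStates hLs hgs h1 hcap)
    hcut

/-- **Two-sided bracket for torus-limit ground states of the `d`-wave sourced torus** (three certified
energies: cuts at `h₁ < h < h₂`, cap at `h`). [cite: KomaTasaki1994, §1] -/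
theorem re_expect_localPairAt_mem_Icc_of_dWaveSource_groundStates {ω : InfVolFermionState 2}
    {ψ : ∀ L, Fock (Orb (FermionTorus 2 L))} {Ls : ℕ → ℕ} (hω : ω.IsTorusLimitOf ψ Ls)
    (hLs : Tendsto Ls atTop atTop) {h : ℝ}
    (hgs : ∀ (j : ℕ) [NeZero (Ls j)], dWaveSourceTorus (Ls j) U μ h *ᵥ ψ (Ls j) =
      (((dWaveSourceTorus (Ls j) U μ h).groundEnergy : ℝ) : ℂ) • ψ (Ls j))
    (h1 : ∀ j, star (ψ (Ls j)) ⬝ᵥ ψ (Ls j) = 1) {h₁ h₂ u ℓ₁ ℓ₂ : ℝ} (hlo : h₁ < h) (hhi : h < h₂)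
    (hcap : ∃ L₀ : ℕ, ∀ (L : ℕ) [NeZero L], L₀ ≤ L → (dWaveSourceTorus L U μ h).groundEnergy ≤ u * (L : ℝ) ^ 2)
    (hcut₁ : ∃ L₀ : ℕ, ∀ (L : ℕ) [NeZero L], L₀ ≤ L → ℓ₁ * (L : ℝ) ^ 2 ≤ (dWaveSourceTorus L U μ h₁).groundEnergy)
    (hcut₂ : ∃ L₀ : ℕ, ∀ (L : ℕ) [NeZero L], L₀ ≤ L → ℓ₂ * (L : ℝ) ^ 2 ≤ (dWaveSourceTorus L U μ h₂).groundEnergy) :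
    (ω.expect (pairRegion (insert (0 : Site 2) unitSteps) 0)
        (localPairAt (insert (0 : Site 2) unitSteps) dWaveFormFactor 0)).re ∈
      Set.Icc ((ℓ₁ - u) / (2 * (h - h₁))) ((u - ℓ₂) / (2 * (h₂ - h))) :=
  ⟨le_re_expect_localPairAt_of_dWaveSource_groundStates hω hLs hgs h1 hlo hcap hcut₁,
    re_expect_localPairAt_le_of_dWaveSource_groundStates hω hLs hgs h1 hhi hcap hcut₂⟩

/-- **Sign node**: at `h > 0` every torus-limit ground state of the `d`-wave sourced torus has `0 ≤ Re ω(P₀)`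
(the lower bracket with `h₁ = 0`, cut `ℓ = E₀(A_L(0))/L²`-wise and cap = the ground energy, using
`E₀(A_L(h)) ≤ E₀(A_L(0))` — the source never raises the energy, `groundEnergy_dWaveSourceTorus_le`).
[cite: KomaTasaki1994, §1] -/
theorem re_expect_localPairAt_nonneg_of_dWaveSource_groundStates {ω : InfVolFermionState 2}
    {ψ : ∀ L, Fock (Orb (FermionTorus 2 L))} {Ls : ℕ → ℕ} (hω : ω.IsTorusLimitOf ψ Ls)
    (hLs : Tendsto Ls atTop atTop) {h : ℝ} (hh : 0 < h)
    (hgs : ∀ (j : ℕ) [NeZero (Ls j)], dWaveSourceTorus (Ls j) U μ h *ᵥ ψ (Ls j) =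
      (((dWaveSourceTorus (Ls j) U μ h).groundEnergy : ℝ) : ℂ) • ψ (Ls j))
    (h1 : ∀ j, star (ψ (Ls j)) ⬝ᵥ ψ (Ls j) = 1) :
    0 ≤ (ω.expect (pairRegion (insert (0 : Site 2) unitSteps) 0)
        (localPairAt (insert (0 : Site 2) unitSteps) dWaveFormFactor 0)).re := by
  set Λ := pairRegion (insert (0 : Site 2) unitSteps) 0
  set P : FermionOp Λ := localPairAt (insert (0 : Site 2) unitSteps) dWaveFormFactor 0
  have hlim : Tendsto (fun j => (torusAvgExpect (Ls j) Λ P (ψ (Ls j))).re) atTop (𝓝 (ω.expect Λ P).re) :=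
    (Complex.continuous_re.tendsto _).comp (hω Λ P)
  refine ge_of_tendsto hlim ?_
  filter_upwards [eventually_injOn_proj_of_tendsto Λ hLs, hLs.eventually_ge_atTop 1] with j hInj hjL
  haveI : NeZero (Ls j) := ⟨by omega⟩
  rw [torusAvgExpect_eq]
  -- finite torus: cut at `h₁ = 0` with `ℓ L² = E₀(A_L(0))`, cap `u L² = E₀(A_L(h))`, and `E₀(A_L(h)) ≤ E₀(A_L(0))`
  have hL : (0 : ℝ) < ((Ls j : ℕ) : ℝ) ^ 2 := cast_sq_pos_of_neZero (Ls j)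
  have hcap : (expect (hubbardTorusWith 2 (Ls j) 1 U μ - (h : ℂ) • (pairField dWaveFormFactor (Ls j) +
      (pairField dWaveFormFactor (Ls j))ᴴ)) (ψ (Ls j))).re ≤
      ((dWaveSourceTorus (Ls j) U μ h).groundEnergy / ((Ls j : ℕ) : ℝ) ^ 2) * ((Ls j : ℕ) : ℝ) ^ 2 := by
    rw [← dWaveSourceTorus_eq, expect, re_rayleigh_eq_groundEnergy_of_eigen (h1 j) (hgs j), div_mul_cancel₀ _ hL.ne']
  have hcut : ((dWaveSourceTorus (Ls j) U μ 0).groundEnergy / ((Ls j : ℕ) : ℝ) ^ 2) * ((Ls j : ℕ) : ℝ) ^ 2 ≤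
      (hubbardTorusWith 2 (Ls j) 1 U μ - ((0 : ℝ) : ℂ) • (pairField dWaveFormFactor (Ls j) +
        (pairField dWaveFormFactor (Ls j))ᴴ)).groundEnergy := by
    rw [← dWaveSourceTorus_eq, div_mul_cancel₀ _ hL.ne']
  have hfin := le_re_torusAvgExpectAt_localPairAt_of_cut_of_cap dWaveFormFactor
    (isHermitian_hubbardTorusWith (Ls j) 1 U μ) hInj hh (h1 j) hcap hcut
  refine le_trans ?_ hfin
  have hE := groundEnergy_dWaveSourceTorus_le (L := Ls j) U μ h
  have hnum : 0 ≤ (dWaveSourceTorus (Ls j) U μ 0).groundEnergy / ((Ls j : ℕ) : ℝ) ^ 2 -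
      (dWaveSourceTorus (Ls j) U μ h).groundEnergy / ((Ls j : ℕ) : ℝ) ^ 2 := by
    rw [← sub_div]; exact div_nonneg (sub_nonneg.2 hE) hL.le
  have hden : 0 < 2 * (h - 0) := by linarith
  exact div_nonneg hnum hden.le

end DWave

/-! ### §4 The tracial stair `m_L(h) = dWaveSourceDensity L U μ h` -/

section Stair

variable (U μ : ℝ)

/-- **Tracial UPPER bracket, finite torus**: for `h < h₂`, a cap `E₀(A_L(h)) ≤ u·L²` and a cut
`ℓ·L² ≤ E₀(A_L(h₂))` give `m_L(h) ≤ (u − ℓ)/(2(h₂ − h))` (the cap is taken AT `h`, generalising obs-p1's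
`dWaveSourceDensity_le_of_energy_window`, cap at `0`). [cite: KomaTasaki1994, §1] -/
theorem dWaveSourceDensity_le_of_cap_of_cut (L : ℕ) [NeZero L] {h h₂ u ℓ : ℝ} (hlt : h < h₂)
    (hcap : (dWaveSourceTorus L U μ h).groundEnergy ≤ u * (L : ℝ) ^ 2)
    (hcut : ℓ * (L : ℝ) ^ 2 ≤ (dWaveSourceTorus L U μ h₂).groundEnergy) :
    dWaveSourceDensity L U μ h ≤ (u - ℓ) / (2 * (h₂ - h)) := by
  have h1 := dWaveSourceDensity_mul_le_groundEnergy_drop (L := L) U μ h h₂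
  have hL : (0 : ℝ) < (L : ℝ) ^ 2 := cast_sq_pos_of_neZero L
  have hδ : 0 < h₂ - h := sub_pos.2 hlt
  rw [le_div_iff₀ (by positivity)]
  have h3 : (h₂ - h) * (2 * (L : ℝ) ^ 2 * dWaveSourceDensity L U μ h) ≤ (u - ℓ) * (L : ℝ) ^ 2 := by
    nlinarith [h1, hcap, hcut]
  by_contra hcon
  push Not at hcon
  nlinarith [mul_lt_mul_of_pos_right hcon hL, h3]

/-- **Tracial LOWER bracket, finite torus**: for `h₁ < h`, a cut `ℓ·L² ≤ E₀(A_L(h₁))` and a cap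
`E₀(A_L(h)) ≤ u·L²` give `(ℓ − u)/(2(h − h₁)) ≤ m_L(h)`. [cite: KomaTasaki1994, §1] -/
theorem le_dWaveSourceDensity_of_cut_of_cap (L : ℕ) [NeZero L] {h₁ h u ℓ : ℝ} (hlt : h₁ < h)
    (hcut : ℓ * (L : ℝ) ^ 2 ≤ (dWaveSourceTorus L U μ h₁).groundEnergy)
    (hcap : (dWaveSourceTorus L U μ h).groundEnergy ≤ u * (L : ℝ) ^ 2) :
    (ℓ - u) / (2 * (h - h₁)) ≤ dWaveSourceDensity L U μ h := by
  have h1 := dWaveSourceDensity_mul_le_groundEnergy_drop (L := L) U μ h h₁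
  have hL : (0 : ℝ) < (L : ℝ) ^ 2 := cast_sq_pos_of_neZero L
  have hδ : 0 < h - h₁ := sub_pos.2 hlt
  rw [div_le_iff₀ (by positivity)]
  -- `(h₁ − h)·2L²·m ≤ E(h) − E(h₁) ≤ uL² − ℓL²`
  have h3 : (ℓ - u) * (L : ℝ) ^ 2 ≤ (h - h₁) * (2 * (L : ℝ) ^ 2 * dWaveSourceDensity L U μ h) := by
    nlinarith [h1, hcap, hcut]
  by_contra hcon
  push Not at hcon
  nlinarith [mul_lt_mul_of_pos_right hcon hL, h3]

/-- Reindexing: an `∃ L₀, ∀ L ≥ L₀` bound is an `∀ᶠ L, … (L+1) …` bound. [folklore] -/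
private theorem eventually_succ_of_exists {P : ∀ (L : ℕ) [NeZero L], Prop}
    (hP : ∃ L₀ : ℕ, ∀ (L : ℕ) [NeZero L], L₀ ≤ L → P L) : ∀ᶠ L : ℕ in atTop, P (L + 1) := by
  obtain ⟨L₀, hL₀⟩ := hP
  filter_upwards [eventually_ge_atTop L₀] with L hL using hL₀ (L + 1) (by omega)

/-- **The stair FLOOR from two certified energies**: for `h₁ < h`, eventual bounds
`ℓ·L² ≤ E₀(A_L(h₁))` and `E₀(A_L(h)) ≤ u·L²` give `(ℓ − u)/(2(h − h₁)) ≤ liminf_L m_{L+1}(h)` — a floor on ONE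
Koma–Tasaki stair `F(U,μ,h)`, the input a finite-`h` KLS/Koma–Tasaki inequality consumes (all stairs `h ↓ 0`
would be `dWaveOrderParameter`, `le_dWaveOrderParameter_iff_forall`); any real `h` (no sign needed).
[cite: KomaTasaki1994, §1] [cite: KennedyLiebShastry1988, §1] -/
theorem le_liminf_dWaveSourceDensity_of_cut_of_cap {h₁ h u ℓ : ℝ} (hlt : h₁ < h)
    (hcut : ∃ L₀ : ℕ, ∀ (L : ℕ) [NeZero L], L₀ ≤ L → ℓ * (L : ℝ) ^ 2 ≤ (dWaveSourceTorus L U μ h₁).groundEnergy)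
    (hcap : ∃ L₀ : ℕ, ∀ (L : ℕ) [NeZero L], L₀ ≤ L → (dWaveSourceTorus L U μ h).groundEnergy ≤ u * (L : ℝ) ^ 2) :
    (ℓ - u) / (2 * (h - h₁)) ≤ liminf (fun L : ℕ => dWaveSourceDensity (L + 1) U μ h) atTop := by
  have hev : ∀ᶠ L : ℕ in atTop, (ℓ - u) / (2 * (h - h₁)) ≤ dWaveSourceDensity (L + 1) U μ h := by
    filter_upwards [eventually_succ_of_exists (P := fun L _ => ℓ * (L : ℝ) ^ 2 ≤ (dWaveSourceTorus L U μ h₁).groundEnergy) hcut,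
      eventually_succ_of_exists (P := fun L _ => (dWaveSourceTorus L U μ h).groundEnergy ≤ u * (L : ℝ) ^ 2) hcap]
      with L hc hu
    exact le_dWaveSourceDensity_of_cut_of_cap U μ (L + 1) hlt hc hu
  refine le_liminf_of_le ?_ hev
  exact isCoboundedUnder_ge_of_eventually_le atTop
    (x := 2 * ∑ e ∈ insert (0 : Site 2) unitSteps, |dWaveFormFactor e / Real.sqrt 2|)
    (Eventually.of_forall fun L => dWaveSourceDensity_le_const _ U μ h)

/-- **The stair CEILING from two certified energies**: for `0 ≤ h < h₂`, eventual bounds `E₀(A_L(h)) ≤ u·L²`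
and `ℓ·L² ≤ E₀(A_L(h₂))` give `limsup_L m_{L+1}(h) ≤ (u − ℓ)/(2(h₂ − h))` (hence the same for the liminf stair
and, via `dWaveOrderParameter_le_liminf`, for the order parameter when `0 < h`). [cite: KomaTasaki1994, §1] -/
theorem limsup_dWaveSourceDensity_le_of_cap_of_cut {h h₂ u ℓ : ℝ} (hh : 0 ≤ h) (hlt : h < h₂)
    (hcap : ∃ L₀ : ℕ, ∀ (L : ℕ) [NeZero L], L₀ ≤ L → (dWaveSourceTorus L U μ h).groundEnergy ≤ u * (L : ℝ) ^ 2)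
    (hcut : ∃ L₀ : ℕ, ∀ (L : ℕ) [NeZero L], L₀ ≤ L → ℓ * (L : ℝ) ^ 2 ≤ (dWaveSourceTorus L U μ h₂).groundEnergy) :
    limsup (fun L : ℕ => dWaveSourceDensity (L + 1) U μ h) atTop ≤ (u - ℓ) / (2 * (h₂ - h)) := by
  have hev : ∀ᶠ L : ℕ in atTop, dWaveSourceDensity (L + 1) U μ h ≤ (u - ℓ) / (2 * (h₂ - h)) := by
    filter_upwards [eventually_succ_of_exists (P := fun L _ => (dWaveSourceTorus L U μ h).groundEnergy ≤ u * (L : ℝ) ^ 2) hcap,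
      eventually_succ_of_exists (P := fun L _ => ℓ * (L : ℝ) ^ 2 ≤ (dWaveSourceTorus L U μ h₂).groundEnergy) hcut]
      with L hu hc
    exact dWaveSourceDensity_le_of_cap_of_cut U μ (L + 1) hlt hu hc
  refine limsup_le_of_le ?_ hev
  exact isCoboundedUnder_le_of_eventually_le atTop (x := 0)
    (Eventually.of_forall fun L => dWaveSourceDensity_nonneg U μ hh)

/-- The order-parameter form of the stair ceiling (for `0 < h < h₂`): `dWaveOrderParameter U μ ≤ (u − ℓ)/(2(h₂ − h))`
from a cap AT `h` and a cut at `h₂` — obs-p1's `dWaveOrderParameter_le_of_sourced_energy_window'` re-keyed to the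
certificate shape of record `∃ L₀, ∀ L ≥ L₀`. [cite: KomaTasaki1994, §1] -/
theorem dWaveOrderParameter_le_of_cap_of_cut {h h₂ u ℓ : ℝ} (hh : 0 < h) (hlt : h < h₂)
    (hcap : ∃ L₀ : ℕ, ∀ (L : ℕ) [NeZero L], L₀ ≤ L → (dWaveSourceTorus L U μ h).groundEnergy ≤ u * (L : ℝ) ^ 2)
    (hcut : ∃ L₀ : ℕ, ∀ (L : ℕ) [NeZero L], L₀ ≤ L → ℓ * (L : ℝ) ^ 2 ≤ (dWaveSourceTorus L U μ h₂).groundEnergy) :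
    dWaveOrderParameter U μ ≤ (u - ℓ) / (2 * (h₂ - h)) := by
  refine (dWaveOrderParameter_le_liminf U μ hh).trans ((liminf_le_limsup ?_ ?_).trans
    (limsup_dWaveSourceDensity_le_of_cap_of_cut U μ hh.le hlt hcap hcut))
  · exact isBoundedUnder_of ⟨2 * ∑ e ∈ insert (0 : Site 2) unitSteps, |dWaveFormFactor e / Real.sqrt 2|,
      fun L => dWaveSourceDensity_le_const _ U μ h⟩
  · exact isBoundedUnder_of ⟨0, fun L => dWaveSourceDensity_nonneg U μ hh.le⟩

end Stair

/-! ### §5 Today's inputs: caps from the canonical source-free table; what the FLOOR side needs -/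

section Inputs

/-- **The cap at ANY source `h` from a canonical source-free UPPER row** (Legendre + "the source never raises
the energy"): for `U ≥ 0`, a density `0 ≤ n < 2` with `energyDensityTT' 1 0 U n ≤ hi`, any `μ`, any real `h` and any
`u > hi − μn`, the sourced ground energies satisfy `E₀(dWaveSourceTorus L U μ h) ≤ u·L²` for all large `L`, in the
`∃ L₀, ∀ L ≥ L₀` shape. [cite: KomaTasaki1994, §1] [cite: Tasaki2020, §2.1] -/
theorem exists_groundEnergy_dWaveSourceTorus_le_of_canonical_upper {U : ℝ} (hU : 0 ≤ U) (μ : ℝ) {n : ℝ}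
    (hn0 : 0 ≤ n) (hn2 : n < 2) {hi : ℝ} (hhi : energyDensityTT' 1 0 U n ≤ hi) (h : ℝ) {u : ℝ}
    (hu : hi - μ * n < u) :
    ∃ L₀ : ℕ, ∀ (L : ℕ) [NeZero L], L₀ ≤ L → (dWaveSourceTorus L U μ h).groundEnergy ≤ u * (L : ℝ) ^ 2 := by
  have hev := eventually_groundEnergy_dWaveSourceTorus_zero_le hU μ hn0 hn2 (u₀ := u) (by linarith)
  obtain ⟨N, hN⟩ := Filter.eventually_atTop.1 hev
  refine ⟨N + 1, fun L _ hL => ?_⟩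
  obtain ⟨k, rfl⟩ : ∃ k, L = k + 1 := ⟨L - 1, by omega⟩
  exact (groundEnergy_dWaveSourceTorus_le (L := k + 1) U μ h).trans (hN k (by omega))

/-- **UPPER Hellmann–Feynman bracket fed by today's table** (a canonical energy UPPER row `e(1,0,U,n) ≤ hi` at ANY
density `n`, a free `μ`, and ONE sourced LOWER certificate `ℓ·L² ≤ E₀(A_L(h₂))` at `h₂ > h`): every torus-limit
ground state `ω` of `dWaveSourceTorus · U μ h` has `Re ω(P₀) ≤ (hi − μn − ℓ)/(2(h₂ − h))` — the every-ground-state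
companion of obs-p1's order-parameter ceiling `dWaveOrderParameter_le_of_canonical_upper_of_sourced_lower`.
[cite: KomaTasaki1994, §1] -/
theorem re_expect_localPairAt_le_of_canonical_upper_of_sourced_lower {U : ℝ} (hU : 0 ≤ U) (μ : ℝ) {n : ℝ}
    (hn0 : 0 ≤ n) (hn2 : n < 2) {hi : ℝ} (hhi : energyDensityTT' 1 0 U n ≤ hi)
    {ω : InfVolFermionState 2} {ψ : ∀ L, Fock (Orb (FermionTorus 2 L))} {Ls : ℕ → ℕ} (hω : ω.IsTorusLimitOf ψ Ls)
    (hLs : Tendsto Ls atTop atTop) {h : ℝ}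
    (hgs : ∀ (j : ℕ) [NeZero (Ls j)], dWaveSourceTorus (Ls j) U μ h *ᵥ ψ (Ls j) =
      (((dWaveSourceTorus (Ls j) U μ h).groundEnergy : ℝ) : ℂ) • ψ (Ls j))
    (h1 : ∀ j, star (ψ (Ls j)) ⬝ᵥ ψ (Ls j) = 1) {h₂ ℓ : ℝ} (hlt : h < h₂)
    (hcut : ∃ L₀ : ℕ, ∀ (L : ℕ) [NeZero L], L₀ ≤ L → ℓ * (L : ℝ) ^ 2 ≤ (dWaveSourceTorus L U μ h₂).groundEnergy) :
    (ω.expect (pairRegion (insert (0 : Site 2) unitSteps) 0)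
        (localPairAt (insert (0 : Site 2) unitSteps) dWaveFormFactor 0)).re ≤ (hi - μ * n - ℓ) / (2 * (h₂ - h)) := by
  have hδ : 0 < 2 * (h₂ - h) := by linarith
  refine le_of_forall_pos_le_add fun ε hε => ?_
  have hcap := exists_groundEnergy_dWaveSourceTorus_le_of_canonical_upper hU μ hn0 hn2 hhi h
    (u := hi - μ * n + ε * (2 * (h₂ - h))) (by nlinarith [mul_pos hε hδ])
  have hle := re_expect_localPairAt_le_of_dWaveSource_groundStates hω hLs hgs h1 hlt hcap hcut
  have heq : (hi - μ * n + ε * (2 * (h₂ - h)) - ℓ) / (2 * (h₂ - h)) = (hi - μ * n - ℓ) / (2 * (h₂ - h)) + ε := by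
    rw [show hi - μ * n + ε * (2 * (h₂ - h)) - ℓ = (hi - μ * n - ℓ) + ε * (2 * (h₂ - h)) by ring, add_div,
      mul_div_cancel_right₀ ε hδ.ne']
  rw [heq] at hle
  exact hle

/-- **What the FLOOR side needs (honesty node).** A cut below `h` can never beat a cap inherited from the
source-free problem: if `ℓ·L² ≤ E₀(A_L(h₁))` and `E₀(A_L(0)) ≤ u₀·L²` on one torus then `ℓ ≤ u₀`
(`E₀(A_L(h₁)) ≤ E₀(A_L(0))`, the source never raises the energy). Hence with `u = u₀` the lower bracket
`(ℓ − u)/(2(h − h₁))` is `≤ 0`, i.e. vacuous: a positive FLOOR on the sourced pair amplitude requires a cap at `h`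
from a SOURCED variational state whose certified energy lies strictly BELOW the certified source-free lower edge —
the ask to the upper crew / pilots. [cite: KomaTasaki1994, §1] -/
theorem cut_le_cap_of_sourceFree_cap (L : ℕ) [NeZero L] (U μ : ℝ) {h₁ ℓ u₀ : ℝ}
    (hcut : ℓ * (L : ℝ) ^ 2 ≤ (dWaveSourceTorus L U μ h₁).groundEnergy)
    (hcap0 : (dWaveSourceTorus L U μ 0).groundEnergy ≤ u₀ * (L : ℝ) ^ 2) : ℓ ≤ u₀ := by
  have hE := groundEnergy_dWaveSourceTorus_le (L := L) U μ h₁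
  have hL : (0 : ℝ) < (L : ℝ) ^ 2 := cast_sq_pos_of_neZero L
  exact le_of_mul_le_mul_right ((hcut.trans hE).trans hcap0) hL

/-- … and the vacuity made explicit: under a source-free cap reused at `h`, the floor value is `≤ 0`. [folklore] -/
theorem floor_nonpos_of_sourceFree_cap (L : ℕ) [NeZero L] (U μ : ℝ) {h₁ h ℓ u₀ : ℝ} (hlt : h₁ < h)
    (hcut : ℓ * (L : ℝ) ^ 2 ≤ (dWaveSourceTorus L U μ h₁).groundEnergy)
    (hcap0 : (dWaveSourceTorus L U μ 0).groundEnergy ≤ u₀ * (L : ℝ) ^ 2) :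
    (ℓ - u₀) / (2 * (h - h₁)) ≤ 0 :=
  div_nonpos_of_nonpos_of_nonneg (sub_nonpos.2 (cut_le_cap_of_sourceFree_cap L U μ hcut hcap0)) (by linarith)

end Inputs

end Summit.Ventures.CertifiedManyBodySolver.Observables

end
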